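import Mathlib
import Literature.NumberTheory.MahlerMeasure.IntegerMahlerMeasure
import Literature.NumberTheory.MahlerMeasure.MinimalMeasuresByDegree
import Literature.NumberTheory.MahlerMeasure.CyclotomicIntegerHeightBound
import Literature.NumberTheory.MahlerMeasure.SmallMeasureStructure
import Literature.NumberTheory.MahlerMeasure.DobrowolskiTheorem
import Literature.NumberTheory.MahlerMeasure.SmythIsolation
import HarnessLib

/-!
# Schinzel's theorem `φ^{deg α} ≤ M(α)²` and the Amoroso–Dvornicich 2-adic bound `2^{deg α} ≤ M(α)⁶` for cyclotomic integers, with sharpness and a house bound (Schinzel 1973; McKee–Smyth Ex. 14.11; Bombieri–Gubler 4.4.9) — re-homed proofs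

**Schinzel's theorem and the 2-adic Amoroso–Dvornicich bound for cyclotomic integers** (Schinzel 1973; McKee–Smyth, *Around the Unit Circle*, Exercise 14.11 p.231; Bombieri–Gubler Thm 4.4.9): for an algebraic integer `α` of a cyclotomic field with `M(α) > 1` (hypotheses exactly as printed in the Part headers) — `φ^{deg α} ≤ M(α)²` with `φ` the golden ratio (sharp: `α = 1 + ζ₅ + ζ₅⁴ = φ`), hence a conjugate with `|α'|² ≥ φ`; and `2^{deg α} ≤ M(α)⁶` from the `p = 2` resultant inequalities, hence a conjugate with `|α'|¹⁰ ≥ 2` (a uniform house bound) — completing the cyclotomic-integer story of `CyclotomicIntegerHeightBound.lean` (Lehmer's bound `M(α) ≥ M(L)` for cyclotomic integers, Bombieri–Gubler 4.4.9 for odd `p`). RE-HOMED into `Literature/` by the Hodge foundations lane (`lit-hodgefound`, seat p20, generation 36) from the venture cell `pub-namedobj` (seat `pub-namedobj-mahler`): verbatim DECLARATION-LEVEL ports, in dependency order and each with its original module docstring, of `Summits/Ventures/DiscreteObjects/Mahler/{LehmerLowerBound (1), CyclotomicIntegerSchinzel (all 4), CyclotomicIntegerSchinzelMeasure (all 3),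 CyclotomicIntegerTwoAdic (all 10), CyclotomicIntegerProdBoundTwo (1), CyclotomicIntegerLehmerTwo (1), CyclotomicFieldIntegersSchinzel (all 2), CyclotomicIntegerSchinzelSharp (all 3), CyclotomicIntegerHouse (1)}.lean`, namespace `Summit.Ventures.DiscreteObjects.Mahler` re-rooted as `Literature.NumberTheory.MahlerMeasure` (this file's path namespace).  Theorems only unless said otherwise; imports Mathlib/Literature only; every declaration carries the citation of the printed statement it formalises; declarations the cone shares with earlier ports (`IntegerMahlerMeasure`, `SmythNonreciprocalTheorem`, `SmythIsolation`, `SmallMeasureStructure`, `CyclotomicIntegerHeightBound`, `DobrowolskiTheorem`, `PerronAlgebraicInteger`) are imported, never restated; the cell's `lehmerPoly` is the tree's `lehmerPolynomial` (`MinimalMeasuresByDegree.lean`, identical body) and is NOT re-declared.  The Summits originals stay in place (transitional duplication).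
-/

noncomputable section

/-!
## Part 1 — port of `Summits/Ventures/DiscreteObjects/Mahler/LehmerLowerBound.lean` (1 declarations kept)

# A kernel-checked lower bound for the Mahler measure of Lehmer's polynomial

Cell `pub-namedobj`, target (L). Framing: lottery ticket; floor = certified bounds/negative ranges.

We prove `117628 / 100000 < M(L)` for Lehmer's polynomial `L = x¹⁰+x⁹-x⁷-x⁶-x⁵-x⁴-x³+x+1`
(`Literature.NumberTheory.MahlerMeasure.lehmerPolynomial`): `L(117628/100000) < 0 < L(117629/100000)`, so
by the intermediate value theorem `L` has a real root `α ∈ (1.17628, 1.17629)`; a root of a monic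
polynomial is bounded by its Mahler measure (`M = ∏ max(1,|αᵢ|)`), hence `1.17628 < α ≤ M(L)`.
(The cell's certified value is `M(L) = 1.1762808182599175065440703384740350506934158…`, three
independent engines; the matching upper bound needs the location of the other nine roots and is
not proved here.)
-/

section Part1

namespace Literature.NumberTheory.MahlerMeasure

open _root_.Polynomial

/-- **Lower bound for Lehmer's measure, kernel-checked:** `1.17628 < M(L)`.
[cite: MckeeSmyth2021, §1.1 p.22 (M(L) = 1.17628…: lower enclosure)] -/
theorem lehmer_measure_lower_bound : (117628 : ℝ) / 100000 < intMahlerMeasure lehmerPolynomial := by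
  set f : ℝ → ℝ := fun x => x ^ 10 + x ^ 9 - x ^ 7 - x ^ 6 - x ^ 5 - x ^ 4 - x ^ 3 + x + 1 with hf
  have hcont : Continuous f := by
    rw [hf]; fun_prop
  have ha : f (117628 / 100000) < 0 := by rw [hf]; norm_num
  have hb : 0 < f (117629 / 100000) := by rw [hf]; norm_num
  have hab : (117628 : ℝ) / 100000 ≤ 117629 / 100000 := by norm_num
  obtain ⟨α, hαI, hαf⟩ : ∃ α ∈ Set.Ioo ((117628 : ℝ) / 100000) (117629 / 100000), f α = 0 := by
    have hsub := intermediate_value_Ioo hab hcont.continuousOn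
    exact hsub ⟨ha, hb⟩
  have hroot : aeval (α : ℂ) lehmerPolynomial = 0 := by
    rw [aeval_lehmerPoly]
    have h0 : α ^ 10 + α ^ 9 - α ^ 7 - α ^ 6 - α ^ 5 - α ^ 4 - α ^ 3 + α + 1 = 0 := hαf
    exact_mod_cast congrArg (fun r : ℝ => (r : ℂ)) h0
  have hle : ‖(α : ℂ)‖ ≤ intMahlerMeasure lehmerPolynomial := norm_root_le_intMahlerMeasure lehmerPoly_monic hroot
  have hpos : 0 ≤ α := by linarith [hαI.1]
  rw [Complex.norm_real, Real.norm_of_nonneg hpos] at hle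
  linarith [hαI.1]

end Literature.NumberTheory.MahlerMeasure

end Part1

/-!
## Part 2 — port of `Summits/Ventures/DiscreteObjects/Mahler/CyclotomicIntegerSchinzel.lean` (4 declarations kept)

# Schinzel's bound for cyclotomic integers: `φ^{φ(m)} ≤ (∏_μ max(1,|g(μ)|))²` (venture `DiscreteObjects`, target L)

Cell `pub-namedobj`, seat `pub-namedobj-mahler-g28`. Framing: lottery ticket; floor = certified bounds/negative ranges.

A. Schinzel, *On the product of the conjugates outside the unit circle of an algebraic number*, Acta Arith. 24 (1973),
the CM-field case, for the cyclotomic integers `α = g(ζ_m)`, by the one-line proof of Höhn–Skoruppa already in the tree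
(`SchinzelTotallyPositive.goldenRatio_mul_rpow_le_max`: `φ · x^a |x-1|^b ≤ max(1,x)`, [McKee–Smyth Ex. 14.11]):
**for `m ≥ 1`, `ζ` a primitive `m`-th root of unity and `g ∈ ℤ[X]` with `g(ζ) ≠ 0` not a root of unity,
`φ^{φ(m)} ≤ (∏_μ max(1,|g(μ)|))²`** over the primitive `m`-th roots of unity, `φ = (1+√5)/2`
(`goldenRatio_pow_totient_le_prod_sq`).  The numbers `x_μ = |g(μ)|² = g(μ)g(μ^{m-1})` are positive reals whose product
and whose product of `x_μ - 1` are nonzero rational integers (`one_le_norm_prod_aeval_primitiveRoots`); `x_μ ≠ 1` since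
one conjugate of modulus `1` forces all (conjugation of `g(X)g(X^{m-1}) - 1`) and then Kronecker's theorem (Mathlib's
`Polynomial.pow_eq_one_of_mahlerMeasure_eq_one`) makes `g(ζ)` a root of unity.  In Mahler-measure form this is
`M(α)² ≥ φ^{deg α}`, `h(α) ≥ ½ log φ = 0.2406…` (file `CyclotomicIntegerSchinzelMeasure`), sharper for INTEGERS than
[cite: BombieriGubler2001, Theorem 4.4.9] (`log(5/2)/10`, all `α ∈ ℚ(ζ_m)`) and sharp at `α = φ = 1 + ζ₅ + ζ₅⁴`.
REPLICATION of a classical theorem; no new mathematics claimed.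
-/

section Part2

namespace Literature.NumberTheory.MahlerMeasure

open _root_.Polynomial _root_.Finset

/-- The product of an integer-coefficient "norm form" `∏_μ h(μ)` over the primitive `m`-th roots of unity is an
integer; if no factor vanishes, its modulus is `≥ 1`.
[cite: Schinzel1973, Acta Arith. 24 (totally real case); see MckeeSmyth2021 Exercise 14.11 p.231 (Schinzel's bound, Höhn–Skoruppa proof) — for cyclotomic integers: φ^{φ(m)} ≤ (∏_μ max(1,|g(μ)|))²] -/
theorem one_le_norm_prod_aeval_primitiveRoots {m : ℕ} (hm : 0 < m) (h : ℤ[X])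
    (hne : ∀ μ ∈ primitiveRoots m ℂ, aeval μ h ≠ 0) : 1 ≤ ‖∏ μ ∈ primitiveRoots m ℂ, aeval μ h‖ := by
  classical
  set Fc : ℂ[X] := ∏ μ ∈ primitiveRoots m ℂ, (X - C (aeval μ h)) with hFc
  have hFcmon : Fc.Monic := monic_prod_of_monic _ _ (fun _ _ => monic_X_sub_C _)
  obtain ⟨F, hFmap, -, -⟩ := lifts_and_natDegree_eq_and_monic (prod_X_sub_C_aeval_primitiveRoots_lifts hm h) hFcmon
  -- `F(0) = ∏ (-h(μ))`
  have hev : ((F.eval 0 : ℤ) : ℂ) = ∏ μ ∈ primitiveRoots m ℂ, (0 - aeval μ h) := by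
    have h1 : (F.map (Int.castRingHom ℂ)).eval 0 = ((F.eval 0 : ℤ) : ℂ) := by
      rw [eval_map, eval₂_at_zero, eq_intCast, coeff_zero_eq_eval_zero]
    rw [← h1, hFmap, eval_prod]
    refine Finset.prod_congr rfl fun μ _ => ?_
    rw [eval_sub, eval_X, eval_C]
  have hne0 : F.eval 0 ≠ 0 := by
    intro h0
    have h1 := hev
    rw [h0, Int.cast_zero] at h1
    exact (Finset.prod_ne_zero_iff.2 fun μ hμ => sub_ne_zero.2 (hne μ hμ).symm) (by rw [← h1])
  have hnorm : ‖∏ μ ∈ primitiveRoots m ℂ, aeval μ h‖ = ‖((F.eval 0 : ℤ) : ℂ)‖ := by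
    rw [hev, norm_prod, norm_prod]
    refine Finset.prod_congr rfl fun μ _ => ?_
    rw [zero_sub, norm_neg]
  rw [hnorm, Complex.norm_intCast]
  exact_mod_cast Int.one_le_abs hne0

/-- For a primitive `m`-th root of unity `μ` and `g ∈ ℤ[X]`: `g(μ^{m-1}) = conj(g(μ))`, so
`g(μ) · g(μ^{m-1}) = |g(μ)|²`.
[cite: Schinzel1973, Acta Arith. 24 (totally real case); see MckeeSmyth2021 Exercise 14.11 p.231 (Schinzel's bound, Höhn–Skoruppa proof) — for cyclotomic integers: φ^{φ(m)} ≤ (∏_μ max(1,|g(μ)|))²] -/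
theorem aeval_mul_aeval_pow_sub_one {m : ℕ} (hm : 0 < m) (g : ℤ[X]) {μ : ℂ} (hμ : IsPrimitiveRoot μ m) :
    aeval μ g * aeval (μ ^ (m - 1)) g = ((‖aeval μ g‖ ^ 2 : ℝ) : ℂ) := by
  have hconj : (starRingEnd ℂ) μ = μ ^ (m - 1) := by
    have h1 : μ * (starRingEnd ℂ) μ = 1 := by
      rw [Complex.mul_conj, Complex.normSq_eq_norm_sq, hμ.norm'_eq_one hm.ne']; norm_num
    have h2 : μ * μ ^ (m - 1) = 1 := by rw [← pow_succ', Nat.sub_add_cancel hm, hμ.pow_eq_one]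
    have hμ0 : μ ≠ 0 := hμ.ne_zero hm.ne'
    exact mul_left_cancel₀ hμ0 (h1.trans h2.symm)
  have haeval : aeval (μ ^ (m - 1)) g = (starRingEnd ℂ) (aeval μ g) := by
    rw [← hconj, aeval_def, aeval_def, hom_eval₂]
    congr 1
    exact Subsingleton.elim _ _
  rw [haeval, Complex.mul_conj, Complex.normSq_eq_norm_sq]

/-- `(max 1 t)² = max 1 (t²)` for `t ≥ 0`.
[cite: Schinzel1973, Acta Arith. 24 (totally real case); see MckeeSmyth2021 Exercise 14.11 p.231 (Schinzel's bound, Höhn–Skoruppa proof) — for cyclotomic integers: φ^{φ(m)} ≤ (∏_μ max(1,|g(μ)|))²] -/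
theorem max_one_sq_eq {t : ℝ} (ht : 0 ≤ t) : (max 1 t) ^ 2 = max 1 (t ^ 2) := by
  rcases le_total t 1 with h | h
  · rw [max_eq_left h, max_eq_left (by nlinarith), one_pow]
  · rw [max_eq_right h, max_eq_right (by nlinarith)]

/-- **Schinzel's theorem for cyclotomic integers, product form.**  For `m ≥ 1`, a primitive `m`-th root of unity `ζ`,
and `g ∈ ℤ[X]` with `α = g(ζ) ≠ 0` not a root of unity: `φ^{φ(m)} ≤ (∏_μ max(1,|g(μ)|))²`, `φ = (1+√5)/2`, the product
over the primitive `m`-th roots of unity.  Proof (Schinzel 1973 for CM fields, via Höhn–Skoruppa): the numbers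
`x_μ = |g(μ)|² = g(μ) g(μ^{-1})` are positive reals with `∏ x_μ` and `∏ (x_μ - 1)` nonzero integers — `x_μ ≠ 1` because
`|g(μ₀)| = 1` for one `μ₀` forces it for all (conjugation of `g(X)g(X^{m-1}) - 1`) and then Kronecker's theorem makes
`α` a root of unity — and the inequality `φ · x^a |x-1|^b ≤ max(1,x)` (`goldenRatio_mul_rpow_le_max`) multiplies up.
[cite: Schinzel1973, Acta Arith. 24 (totally real case); see MckeeSmyth2021 Exercise 14.11 p.231 (Schinzel's bound, Höhn–Skoruppa proof) — for cyclotomic integers: φ^{φ(m)} ≤ (∏_μ max(1,|g(μ)|))²] -/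
theorem goldenRatio_pow_totient_le_prod_sq {m : ℕ} (hm : 0 < m) (g : ℤ[X]) {ζ : ℂ} (hζ : IsPrimitiveRoot ζ m)
    (h0 : aeval ζ g ≠ 0) (hnu : ∀ k : ℕ, 0 < k → aeval ζ g ^ k ≠ 1) :
    Real.goldenRatio ^ m.totient ≤ (∏ μ ∈ primitiveRoots m ℂ, max 1 ‖aeval μ g‖) ^ 2 := by
  classical
  set S := primitiveRoots m ℂ with hS
  have hcard : S.card = m.totient := (Complex.isPrimitiveRoot_exp m hm.ne').card_primitiveRoots
  -- (1) no conjugate vanishes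
  have hne : ∀ μ ∈ S, aeval μ g ≠ 0 := by
    intro μ hμ hμ0
    exact h0 (aeval_eq_zero_of_primitiveRoot hm ((mem_primitiveRoots hm).1 hμ) hμ0 hζ)
  -- (2) the polynomial `b = g · g(X^{m-1})` with `b(μ) = |g(μ)|²`
  set b : ℤ[X] := g * expand ℤ (m - 1) g with hb
  have hbμ : ∀ μ ∈ S, aeval μ b = ((‖aeval μ g‖ ^ 2 : ℝ) : ℂ) := by
    intro μ hμ
    rw [hb, map_mul, expand_aeval, aeval_mul_aeval_pow_sub_one hm g ((mem_primitiveRoots hm).1 hμ)]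
  -- (3) no conjugate has modulus `1` (Kronecker)
  have hne1 : ∀ μ ∈ S, ‖aeval μ g‖ ^ 2 ≠ 1 := by
    intro μ₀ hμ₀ h1
    have hμ₀' := (mem_primitiveRoots hm).1 hμ₀
    -- `b - 1` vanishes at `μ₀`, hence at every primitive root
    have hQ : aeval μ₀ (b - 1) = 0 := by rw [map_sub, hbμ μ₀ hμ₀, h1, map_one]; push_cast; ring
    have hall : ∀ μ ∈ S, ‖aeval μ g‖ = 1 := by
      intro μ hμ
      have h := aeval_eq_zero_of_primitiveRoot hm hμ₀' hQ ((mem_primitiveRoots hm).1 hμ)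
      rw [map_sub, hbμ μ hμ, map_one, sub_eq_zero] at h
      have h2 : ‖aeval μ g‖ ^ 2 = 1 := by exact_mod_cast h
      nlinarith [norm_nonneg (aeval μ g)]
    -- the integer polynomial `F = ∏ (X - g(μ))` has Mahler measure `1`
    set Fc : ℂ[X] := ∏ μ ∈ S, (X - C (aeval μ g)) with hFc
    have hFcmon : Fc.Monic := monic_prod_of_monic _ _ (fun _ _ => monic_X_sub_C _)
    obtain ⟨F, hFmap, -, -⟩ :=
      lifts_and_natDegree_eq_and_monic (prod_X_sub_C_aeval_primitiveRoots_lifts hm g) hFcmon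
    have hMF : (F.map (Int.castRingHom ℂ)).mahlerMeasure = 1 := by
      rw [hFmap, mahlerMeasure_prod_X_sub_C]
      exact Finset.prod_eq_one fun μ hμ => by rw [hall μ hμ, max_self]
    have hroot : aeval ζ g ∈ F.aroots ℂ := by
      rw [aroots_def, algebraMap_int_eq, hFmap]
      have hmm : ((primitiveRoots m ℂ).val.map fun μ => X - C (aeval μ g)) =
          (((primitiveRoots m ℂ).val.map fun μ => aeval μ g).map fun a : ℂ => X - C a) := by
        rw [Multiset.map_map]; rfl
      rw [Finset.prod_eq_multiset_prod, hmm, roots_multiset_prod_X_sub_C, Multiset.mem_map]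
      exact ⟨ζ, (mem_primitiveRoots hm).2 hζ, rfl⟩
    obtain ⟨n, hn, hn1⟩ := Polynomial.pow_eq_one_of_mahlerMeasure_eq_one hMF h0 hroot
    exact hnu n hn hn1
  -- (4) the pointwise inequality
  set a : ℝ := (1 - 1 / √5) / 2 with ha
  set c : ℝ := 1 / √5 with hc
  have hs0 : (0 : ℝ) < √5 := Real.sqrt_pos.mpr (by norm_num)
  have hs1 : (1 : ℝ) < √5 := by
    have hs2 : (√5 : ℝ) ^ 2 = 5 := Real.sq_sqrt (by norm_num); nlinarith
  have ha0 : 0 ≤ a := by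
    rw [ha]; have : 1 / √5 < 1 := (div_lt_one hs0).mpr hs1; linarith
  have hc0 : 0 ≤ c := by rw [hc]; positivity
  set x : ℂ → ℝ := fun μ => ‖aeval μ g‖ ^ 2 with hx
  have hxpos : ∀ μ ∈ S, 0 < x μ := fun μ hμ => by
    rw [hx]; exact pow_pos (norm_pos_iff.2 (hne μ hμ)) 2
  have hpt : ∀ μ ∈ S, Real.goldenRatio * (x μ ^ a * |x μ - 1| ^ c) ≤ (max 1 ‖aeval μ g‖) ^ 2 := by
    intro μ hμ
    rw [max_one_sq_eq (norm_nonneg _)]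
    exact goldenRatio_mul_rpow_le_max (hxpos μ hμ) (hne1 μ hμ)
  -- (5) multiply
  have hprodle : ∏ μ ∈ S, Real.goldenRatio * (x μ ^ a * |x μ - 1| ^ c) ≤ ∏ μ ∈ S, (max 1 ‖aeval μ g‖) ^ 2 :=
    Finset.prod_le_prod (fun μ _ => by positivity) hpt
  rw [Finset.prod_mul_distrib, Finset.prod_mul_distrib, Finset.prod_const, hcard, Finset.prod_pow,
    Real.finsetProd_rpow S x (fun μ hμ => (hxpos μ hμ).le) a,
    Real.finsetProd_rpow S (fun μ => |x μ - 1|) (fun μ _ => abs_nonneg _) c] at hprodle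
  -- (6) `∏ x_μ ≥ 1` and `∏ |x_μ - 1| ≥ 1`
  have hX1 : 1 ≤ ∏ μ ∈ S, x μ := by
    have h := one_le_norm_prod_aeval_primitiveRoots hm g hne
    rw [norm_prod] at h
    have h2 : ∏ μ ∈ S, x μ = (∏ μ ∈ S, ‖aeval μ g‖) ^ 2 := by rw [hx, Finset.prod_pow]
    rw [h2]
    nlinarith
  have hY1 : 1 ≤ ∏ μ ∈ S, |x μ - 1| := by
    have hne' : ∀ μ ∈ S, aeval μ (b - 1) ≠ 0 := by
      intro μ hμ hz
      rw [map_sub, hbμ μ hμ, map_one, sub_eq_zero] at hz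
      exact hne1 μ hμ (by exact_mod_cast hz)
    have h := one_le_norm_prod_aeval_primitiveRoots hm (b - 1) hne'
    rw [norm_prod] at h
    have h2 : ∏ μ ∈ S, |x μ - 1| = ∏ μ ∈ S, ‖aeval μ (b - 1)‖ := by
      refine Finset.prod_congr rfl fun μ hμ => ?_
      rw [map_sub, hbμ μ hμ, map_one, ← Complex.ofReal_one, ← Complex.ofReal_sub, Complex.norm_real,
        Real.norm_eq_abs]
    rw [h2]; exact h
  have hlow : 1 ≤ (∏ μ ∈ S, x μ) ^ a * (∏ μ ∈ S, |x μ - 1|) ^ c := by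
    have h1 : 1 ≤ (∏ μ ∈ S, x μ) ^ a := Real.one_le_rpow hX1 ha0
    have h2 : 1 ≤ (∏ μ ∈ S, |x μ - 1|) ^ c := Real.one_le_rpow hY1 hc0
    nlinarith
  have hφ0 : 0 < Real.goldenRatio ^ m.totient := pow_pos Real.goldenRatio_pos _
  calc Real.goldenRatio ^ m.totient = Real.goldenRatio ^ m.totient * 1 := (mul_one _).symm
    _ ≤ Real.goldenRatio ^ m.totient * ((∏ μ ∈ S, x μ) ^ a * (∏ μ ∈ S, |x μ - 1|) ^ c) :=
        mul_le_mul_of_nonneg_left hlow hφ0.le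
    _ ≤ (∏ μ ∈ S, max 1 ‖aeval μ g‖) ^ 2 := hprodle

end Literature.NumberTheory.MahlerMeasure

end Part2

/-!
## Part 3 — port of `Summits/Ventures/DiscreteObjects/Mahler/CyclotomicIntegerSchinzelMeasure.lean` (3 declarations kept)

# Schinzel's theorem for cyclotomic integers, Mahler-measure form: `φ^{deg α} ≤ M(α)²` (venture `DiscreteObjects`, target L)

Cell `pub-namedobj`, seat `pub-namedobj-mahler-g28`. Framing: lottery ticket; floor = certified bounds/negative ranges.

Translation of `CyclotomicIntegerSchinzel.goldenRatio_pow_totient_le_prod_sq` (Schinzel 1973, CM case; Höhn–Skoruppa's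
proof) by `CyclotomicIntegerLehmerAll.exists_prod_max_eq_measure_pow`: **for every `m ≥ 1`, every primitive `m`-th root
of unity `ζ ∈ ℂ` and every `g ∈ ℤ[X]` with `α = g(ζ)` neither `0` nor a root of unity, `φ^{deg α} ≤ M(α)²`**,
`φ = (1+√5)/2` (`goldenRatio_pow_le_measure_sq`; `h(α) ≥ ½ log φ = 0.2406…`), hence `M(α) ≥ φ` in degree `≥ 2`
(`goldenRatio_le_measure`, SHARP: `M(x² - x - 1) = φ`, `φ = 1 + ζ₅ + ζ₅⁴`, see `GoldenRatioSharpness`) and a conjugate of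
modulus `≥ √φ = 1.2720…` (`exists_conjugate_norm_sq_ge_goldenRatio`).  For cyclotomic INTEGERS this supersedes in strength
the general abelian bound [cite: BombieriGubler2001, Theorem 4.4.9] (`log(5/2)/10`, `CyclotomicIntegerLehmerAll`) and the
2-adic bound (`(log 2)/6`, `CyclotomicIntegerLehmerTwo`), whose methods however apply to all `α ∈ ℚ(ζ_m)`.
REPLICATION of a classical theorem; no new mathematics claimed.
-/

section Part3

namespace Literature.NumberTheory.MahlerMeasure

open _root_.Polynomial _root_.Finset

/-- **Schinzel's theorem for cyclotomic integers: `φ^{deg α} ≤ M(α)²`.**  For every `m ≥ 1`, every primitive `m`-th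
root of unity `ζ ∈ ℂ` and every `g ∈ ℤ[X]` with `α = g(ζ)` neither `0` nor a root of unity, `φ^{deg α} ≤ M(α)²`,
`φ = (1+√5)/2` — i.e. `h(α) ≥ ½ log φ = 0.2406…`; equality for `α = φ = 1 + ζ₅ + ζ₅⁴` (`M(x² - x - 1) = φ`,
`GoldenRatioSharpness`).
[cite: Schinzel1973, Acta Arith. 24; see MckeeSmyth2021 Exercise 14.11 p.231 — Mahler-measure form for cyclotomic integers: φ^{deg α} ≤ M(α)², some conjugate has |α'|² ≥ φ] -/
theorem goldenRatio_pow_le_measure_sq {m : ℕ} (hm : 0 < m) (g : ℤ[X]) {ζ : ℂ} (hζ : IsPrimitiveRoot ζ m)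
    (h0 : aeval ζ g ≠ 0) (hnu : ∀ k : ℕ, 0 < k → aeval ζ g ^ k ≠ 1) :
    Real.goldenRatio ^ (minpoly ℤ (aeval ζ g)).natDegree ≤ intMahlerMeasure (minpoly ℤ (aeval ζ g)) ^ 2 := by
  obtain ⟨e, he0, hed, hprod⟩ := exists_prod_max_eq_measure_pow hm g hζ
  have hB := goldenRatio_pow_totient_le_prod_sq hm g hζ h0 hnu
  set M := intMahlerMeasure (minpoly ℤ (aeval ζ g)) with hM
  set d := (minpoly ℤ (aeval ζ g)).natDegree with hd
  have hR : (M ^ e) ^ 2 = (M ^ 2) ^ e := by rw [← pow_mul, ← pow_mul, mul_comm]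
  rw [hprod, ← hed, hR, mul_comm e d, pow_mul] at hB
  have hζint : IsIntegral ℤ ζ := hζ.isIntegral hm
  have hαint : IsIntegral ℤ (aeval ζ g) := by
    have hmem : aeval ζ g ∈ Algebra.adjoin ℤ {ζ} := Polynomial.aeval_mem_adjoin_singleton ℤ ζ
    exact (mem_integralClosure_iff ℤ ℂ).1 (adjoin_le_integralClosure hζint hmem)
  have hM0 : 0 ≤ M := le_trans zero_le_one (one_le_intMahlerMeasure (minpoly.monic hαint).ne_zero)
  exact (pow_le_pow_iff_left₀ (by positivity) (by positivity) he0).1 hB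

/-- **`M(α) ≥ φ = 1.618…` for every nonzero non-torsion cyclotomic integer of degree `≥ 2`** (sharp: `α = φ`); in
degree `1`, `M(α) = |α| ≥ 2`.  In particular `M(α) > M(ℓ) = 1.17628…` (Lehmer) with a wide margin.
[cite: Schinzel1973, Acta Arith. 24; see MckeeSmyth2021 Exercise 14.11 p.231 — Mahler-measure form for cyclotomic integers: φ^{deg α} ≤ M(α)², some conjugate has |α'|² ≥ φ] -/
theorem goldenRatio_le_measure {m : ℕ} (hm : 0 < m) (g : ℤ[X]) {ζ : ℂ} (hζ : IsPrimitiveRoot ζ m)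
    (h0 : aeval ζ g ≠ 0) (hnu : ∀ k : ℕ, 0 < k → aeval ζ g ^ k ≠ 1) (hd : 2 ≤ (minpoly ℤ (aeval ζ g)).natDegree) :
    Real.goldenRatio ≤ intMahlerMeasure (minpoly ℤ (aeval ζ g)) := by
  have hB := goldenRatio_pow_le_measure_sq hm g hζ h0 hnu
  have hφ1 : (1 : ℝ) ≤ Real.goldenRatio := Real.one_lt_goldenRatio.le
  have h1 : Real.goldenRatio ^ 2 ≤ intMahlerMeasure (minpoly ℤ (aeval ζ g)) ^ 2 :=
    (pow_le_pow_right₀ hφ1 hd).trans hB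
  have hζint : IsIntegral ℤ ζ := hζ.isIntegral hm
  have hαint : IsIntegral ℤ (aeval ζ g) := by
    have hmem : aeval ζ g ∈ Algebra.adjoin ℤ {ζ} := Polynomial.aeval_mem_adjoin_singleton ℤ ζ
    exact (mem_integralClosure_iff ℤ ℂ).1 (adjoin_le_integralClosure hζint hmem)
  have hM0 : 0 ≤ intMahlerMeasure (minpoly ℤ (aeval ζ g)) :=
    le_trans zero_le_one (one_le_intMahlerMeasure (minpoly.monic hαint).ne_zero)
  exact (pow_le_pow_iff_left₀ Real.goldenRatio_pos.le hM0 two_ne_zero).1 h1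

/-- **A uniform house bound**: every nonzero non-torsion cyclotomic integer has a conjugate `β` with `|β|² ≥ φ`,
i.e. house `≥ √φ = 1.2720…`, uniformly in the degree (sharp: `α = φ`).
[cite: Schinzel1973, Acta Arith. 24; see MckeeSmyth2021 Exercise 14.11 p.231 — Mahler-measure form for cyclotomic integers: φ^{deg α} ≤ M(α)², some conjugate has |α'|² ≥ φ] -/
theorem exists_conjugate_norm_sq_ge_goldenRatio {m : ℕ} (hm : 0 < m) (g : ℤ[X]) {ζ : ℂ} (hζ : IsPrimitiveRoot ζ m)
    (h0 : aeval ζ g ≠ 0) (hnu : ∀ k : ℕ, 0 < k → aeval ζ g ^ k ≠ 1) :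
    ∃ β ∈ ((minpoly ℤ (aeval ζ g)).map (Int.castRingHom ℂ)).roots, Real.goldenRatio ≤ ‖β‖ ^ 2 := by
  classical
  have hζint : IsIntegral ℤ ζ := hζ.isIntegral hm
  have hαint : IsIntegral ℤ (aeval ζ g) := by
    have hmem : aeval ζ g ∈ Algebra.adjoin ℤ {ζ} := Polynomial.aeval_mem_adjoin_singleton ℤ ζ
    exact (mem_integralClosure_iff ℤ ℂ).1 (adjoin_le_integralClosure hζint hmem)
  set f : ℤ[X] := minpoly ℤ (aeval ζ g) with hf
  have hmon : f.Monic := minpoly.monic hαint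
  have hB := goldenRatio_pow_le_measure_sq hm g hζ h0 hnu
  set d := f.natDegree with hd
  have hdpos : 0 < d := minpoly.natDegree_pos hαint
  have hφ1 : (1 : ℝ) < Real.goldenRatio := Real.one_lt_goldenRatio
  have hM1 : 1 ≤ intMahlerMeasure f := one_le_intMahlerMeasure hmon.ne_zero
  have hM : 1 < intMahlerMeasure f := by
    by_contra hle
    have hle' : intMahlerMeasure f ≤ 1 := le_of_not_gt hle
    have h1 : intMahlerMeasure f ^ 2 ≤ 1 := pow_le_one₀ (by linarith) hle'
    have h2 : Real.goldenRatio ≤ Real.goldenRatio ^ d := by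
      calc Real.goldenRatio = Real.goldenRatio ^ 1 := (pow_one _).symm
        _ ≤ Real.goldenRatio ^ d := pow_le_pow_right₀ hφ1.le hdpos
    have h3 : Real.goldenRatio ^ d ≤ intMahlerMeasure f ^ 2 := hB
    linarith
  obtain ⟨z, hz, hz1, hmax⟩ := exists_root_norm_gt_one hmon hM
  refine ⟨z, hz, ?_⟩
  set RC := (f.map (Int.castRingHom ℂ)).roots with hRC
  have hcard : RC.card = d := by
    rw [hRC, splits_iff_card_roots.1 (IsAlgClosed.splits _),
      natDegree_map_eq_of_injective (Int.castRingHom ℂ).injective_int]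
  have hMle : intMahlerMeasure f ≤ ‖z‖ ^ d := by
    have hMf : intMahlerMeasure f = (RC.map fun γ => max 1 ‖γ‖).prod := by
      unfold intMahlerMeasure
      rw [mahlerMeasure_eq_leadingCoeff_mul_prod_roots, (hmon.map (Int.castRingHom ℂ)).leadingCoeff, norm_one,
        one_mul]
    rw [hMf]
    calc (RC.map fun γ => max 1 ‖γ‖).prod ≤ (RC.map fun _ => ‖z‖).prod :=
          Multiset.prod_map_le_prod_map₀ _ _ (fun γ _ => by positivity) (fun γ hγ => max_le hz1.le (hmax γ hγ))
      _ = ‖z‖ ^ d := by rw [Multiset.map_const', Multiset.prod_replicate, hcard]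
  have hM0 : 0 ≤ intMahlerMeasure f := by linarith
  have h1 : Real.goldenRatio ^ d ≤ (‖z‖ ^ 2) ^ d := by
    calc Real.goldenRatio ^ d ≤ intMahlerMeasure f ^ 2 := hB
      _ ≤ (‖z‖ ^ d) ^ 2 := pow_le_pow_left₀ hM0 hMle 2
      _ = (‖z‖ ^ 2) ^ d := by rw [← pow_mul, ← pow_mul, mul_comm]
  exact (pow_le_pow_iff_left₀ Real.goldenRatio_pos.le (by positivity) hdpos.ne').1 h1

end Literature.NumberTheory.MahlerMeasure

end Part3

/-!
## Part 4 — port of `Summits/Ventures/DiscreteObjects/Mahler/CyclotomicIntegerTwoAdic.lean` (10 declarations kept)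

# Cyclotomic integers: the 2-adic resultant inequalities of Amoroso–Dvornicich (venture `DiscreteObjects`, target L)

Cell `pub-namedobj`, seat `pub-namedobj-mahler-g28`. Framing: lottery ticket; floor = certified bounds/negative ranges.

F. Amoroso, R. Dvornicich, *A lower bound for the height in abelian extensions*, J. Number Theory 80 (2000) 260–272,
Lemma 3 and the first display of the proof of Proposition 2 (the prime `2` in place of the odd prime `p` of
[cite: BombieriGubler2001, Theorem 4.4.9]): for a cyclotomic integer `γ ∈ ℤ[ζ_m]`,
(1) `4 ∤ m`: `4 ∣ γ⁴ - σγ²` for the Frobenius-type `σ` (`ζ ↦ ζ²` if `m` is odd; `ζ ↦ ζ^{2+m/2} = -ζ²` if `m ≡ 2 (mod 4)`);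
(2) `4 ∣ m`: `4 ∣ γ² - σγ²` for `σ : ζ ↦ -ζ = ζ^{1+m/2}`, the generator of `Gal(ℚ(ζ_m)/ℚ(ζ_{m/2}))`.
KERNEL FORM over `ℂ` by resultants, as in `CyclotomicIntegerMeasure` / `CyclotomicIntegerRamified`, with
`H = ∏_μ max(1,|g(μ)|)` over the primitive `m`-th roots of unity:
* `two_pow_totient_le_of_four_dvd_poly`: the common resultant estimate `2^{φ(m)} ≤ H^{a+b}` from `V = 4U`,
  `V(μ) = g(μ)^a - g(μ^k)^b ≠ 0`;
* `two_pow_totient_le_of_odd`, `two_pow_totient_le_of_two_mod_four`: **`4 ∤ m` ⇒ `2^{φ(m)} ≤ H^6`** for `g(ζ_m) ≠ 0` not a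
  root of unity (nondegeneracy is automatic: `pow_four_ne_aeval_pow_sq_of_not_torsion`), i.e. `h(α) ≥ (log 2)/6`;
* `two_pow_totient_le_of_four_dvd`: **`4 ∣ m`, `g(μ)² ≠ g(-μ)²` ⇒ `2^{φ(m)} ≤ H^4`**, i.e. `h(α) ≥ (log 2)/4`.
(The published theorem, `h(α) ≥ (log 5)/12`, refines the archimedean estimate — A–D Lemma 4 — and is not reproduced;
with the trivial archimedean bound the method gives `(log 2)/6`, assembled for all `m` in `CyclotomicIntegerLehmerTwo`.)
REPLICATION of the published method; no new mathematics claimed.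
-/

section Part4

namespace Literature.NumberTheory.MahlerMeasure

open _root_.Polynomial _root_.Finset

/-- **The 2-adic resultant inequality** (kernel form of [Amoroso–Dvornicich 2000, Lemma 3]: "`4 ∣ γ⁴ - σγ²`" resp.
"`4 ∣ γ² - σγ²`").  Let `m ≥ 1`, `k` prime to `m`, `g, V, U ∈ ℤ[X]` with `V = 4U` and
`V(μ) = g(μ)^a - g(μ^k)^b` for every primitive `m`-th root of unity `μ`.  If `g(μ)^a ≠ g(μ^k)^b` for every primitive
`μ`, then `2^{φ(m)} ≤ (∏_μ max(1,|g(μ)|))^{a+b}`: `Res(Φ_m, V) = 4^{φ(m)} Res(Φ_m, U)` is a nonzero integer, while over `ℂ`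
it is `∏_μ (g(μ)^a - g(μ^k)^b)`, of modulus `≤ 2^{φ(m)} H^a H^b` (`μ ↦ μ^k` permutes the primitive roots).
[cite: BombieriGubler2001, Theorem 4.4.9 p.110 (Amoroso–Dvornicich: the 2-adic resultant inequalities for cyclotomic integers)] -/
theorem two_pow_totient_le_of_four_dvd_poly {m k a b : ℕ} (hm : 0 < m) (hkcop : k.Coprime m) (g V U : ℤ[X])
    (hVU : V = C (4 : ℤ) * U) (hVμ : ∀ μ ∈ primitiveRoots m ℂ, aeval μ V = aeval μ g ^ a - aeval (μ ^ k) g ^ b)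
    (hsep : ∀ μ ∈ primitiveRoots m ℂ, aeval μ g ^ a ≠ aeval (μ ^ k) g ^ b) :
    (2 : ℝ) ^ m.totient ≤ (∏ μ ∈ primitiveRoots m ℂ, max 1 ‖aeval μ g‖) ^ (a + b) := by
  classical
  set Φ : ℤ[X] := cyclotomic m ℤ with hΦ
  have hΦmon : Φ.Monic := cyclotomic.monic m ℤ
  have hΦdeg : Φ.natDegree = m.totient := natDegree_cyclotomic m ℤ
  set ζ₀ : ℂ := Complex.exp (2 * Real.pi * Complex.I / m) with hζ₀def
  have hζ₀ : IsPrimitiveRoot ζ₀ m := Complex.isPrimitiveRoot_exp m hm.ne'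
  have hroots : (Φ.map (Int.castRingHom ℂ)).roots = (primitiveRoots m ℂ).val := by
    rw [hΦ, map_cyclotomic_int, cyclotomic_eq_prod_X_sub_primitiveRoots hζ₀, roots_prod_X_sub_C]
  have hlc : (Φ.map (Int.castRingHom ℂ)).leadingCoeff = 1 := (hΦmon.map _).leadingCoeff
  have hcard : (primitiveRoots m ℂ).card = m.totient := hζ₀.card_primitiveRoots
  -- `∏_μ V(μ) = Res(Φ, V) = 4^φ Res(Φ, U)`, a nonzero integer
  set N : ℕ := V.natDegree with hN
  have hRes : Φ.resultant V Φ.natDegree N = (4 : ℤ) ^ Φ.natDegree * Φ.resultant U Φ.natDegree N := by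
    rw [hVU, resultant_C_mul_right]
  have hev : ((Φ.resultant V Φ.natDegree N : ℤ) : ℂ) =
      ∏ μ ∈ primitiveRoots m ℂ, (aeval μ g ^ a - aeval (μ ^ k) g ^ b) := by
    rw [resultant_intCast_eq le_rfl, hlc, one_pow, one_mul, hroots]
    change ∏ μ ∈ primitiveRoots m ℂ, (V.map (Int.castRingHom ℂ)).eval μ = _
    refine Finset.prod_congr rfl fun μ hμ => ?_
    rw [eval_map, ← algebraMap_int_eq, ← aeval_def, hVμ μ hμ]
  have hne : Φ.resultant V Φ.natDegree N ≠ 0 := by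
    intro h0
    have h := hev
    rw [h0, Int.cast_zero] at h
    exact (Finset.prod_ne_zero_iff.2 fun μ hμ => sub_ne_zero.2 (hsep μ hμ)) h.symm
  -- lower bound `4^φ ≤ |Res|`
  have hlow : (4 : ℝ) ^ m.totient ≤ ‖((Φ.resultant V Φ.natDegree N : ℤ) : ℂ)‖ := by
    have hU0 : Φ.resultant U Φ.natDegree N ≠ 0 := by
      intro h0
      rw [h0, mul_zero] at hRes
      exact hne hRes
    have h1 : (1 : ℝ) ≤ |(Φ.resultant U Φ.natDegree N : ℝ)| := by exact_mod_cast Int.one_le_abs hU0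
    rw [Complex.norm_intCast, hRes, ← hΦdeg]
    push_cast
    rw [abs_mul, abs_pow, show |(4 : ℝ)| = 4 by norm_num]
    calc (4 : ℝ) ^ Φ.natDegree = (4 : ℝ) ^ Φ.natDegree * 1 := (mul_one _).symm
      _ ≤ (4 : ℝ) ^ Φ.natDegree * |(Φ.resultant U Φ.natDegree N : ℝ)| :=
          mul_le_mul_of_nonneg_left h1 (by positivity)
  -- upper bound `|Res| ≤ 2^φ H^a H^b`
  set H : ℝ := ∏ μ ∈ primitiveRoots m ℂ, max 1 ‖aeval μ g‖ with hH
  have hH0 : 0 ≤ H := Finset.prod_nonneg fun μ _ => by positivity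
  have hup : ‖((Φ.resultant V Φ.natDegree N : ℤ) : ℂ)‖ ≤ 2 ^ m.totient * H ^ a * H ^ b := by
    rw [hev, norm_prod]
    calc ∏ μ ∈ primitiveRoots m ℂ, ‖aeval μ g ^ a - aeval (μ ^ k) g ^ b‖
        ≤ ∏ μ ∈ primitiveRoots m ℂ, (2 * (max 1 ‖aeval μ g‖) ^ a * (max 1 ‖aeval (μ ^ k) g‖) ^ b) := by
          refine Finset.prod_le_prod (fun μ _ => norm_nonneg _) fun μ _ => ?_
          have ha : ‖aeval μ g ^ a‖ ≤ (max 1 ‖aeval μ g‖) ^ a := by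
            rw [norm_pow]; exact pow_le_pow_left₀ (norm_nonneg _) (le_max_right _ _) _
          have hb : ‖aeval (μ ^ k) g ^ b‖ ≤ (max 1 ‖aeval (μ ^ k) g‖) ^ b := by
            rw [norm_pow]; exact pow_le_pow_left₀ (norm_nonneg _) (le_max_right _ _) _
          calc ‖aeval μ g ^ a - aeval (μ ^ k) g ^ b‖ ≤ ‖aeval μ g ^ a‖ + ‖aeval (μ ^ k) g ^ b‖ := norm_sub_le _ _
            _ ≤ (max 1 ‖aeval μ g‖) ^ a + (max 1 ‖aeval (μ ^ k) g‖) ^ b := add_le_add ha hb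
            _ ≤ 2 * (max 1 ‖aeval μ g‖) ^ a * (max 1 ‖aeval (μ ^ k) g‖) ^ b :=
                add_le_two_mul_mul (one_le_pow₀ (le_max_left _ _)) (one_le_pow₀ (le_max_left _ _))
      _ = 2 ^ m.totient * H ^ a * (∏ μ ∈ primitiveRoots m ℂ, max 1 ‖aeval (μ ^ k) g‖) ^ b := by
          rw [Finset.prod_mul_distrib, Finset.prod_mul_distrib, Finset.prod_const, hcard, Finset.prod_pow,
            Finset.prod_pow]
      _ = 2 ^ m.totient * H ^ a * H ^ b := by
          rw [prod_primitiveRoots_pow_eq hm hkcop (fun z => max 1 ‖aeval z g‖)]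
  -- combine: `4^φ ≤ 2^φ H^(a+b)`
  have h := hlow.trans hup
  have h4 : (4 : ℝ) ^ m.totient = 2 ^ m.totient * 2 ^ m.totient := by rw [← mul_pow]; norm_num
  rw [h4] at h
  have h2pos : (0 : ℝ) < 2 ^ m.totient := by positivity
  rw [pow_add]
  nlinarith

/-- The case `V = g⁴ - R²` with `g² - R = 2T`, `R(μ) = g(μ^k)` (conductor odd or `≡ 2 (mod 4)`): `g⁴ - R² = 4·T(g² - T)`,
so `2^{φ(m)} ≤ H^6` in the nondegenerate case.
[cite: BombieriGubler2001, Theorem 4.4.9 p.110 (Amoroso–Dvornicich: the 2-adic resultant inequalities for cyclotomic integers)] -/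
theorem two_pow_totient_le_of_sq_congr {m k : ℕ} (hm : 0 < m) (hkcop : k.Coprime m) (g R T : ℤ[X])
    (hT : g ^ 2 - R = C (2 : ℤ) * T) (hR : ∀ μ ∈ primitiveRoots m ℂ, aeval μ R = aeval (μ ^ k) g)
    (hsep : ∀ μ ∈ primitiveRoots m ℂ, aeval μ g ^ 4 ≠ aeval (μ ^ k) g ^ 2) :
    (2 : ℝ) ^ m.totient ≤ (∏ μ ∈ primitiveRoots m ℂ, max 1 ‖aeval μ g‖) ^ 6 := by
  have hC2 : (C (2 : ℤ) : ℤ[X]) = 2 := by simp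
  have hC4 : (C (4 : ℤ) : ℤ[X]) = 4 := by simp
  have hR' : R = g ^ 2 - C (2 : ℤ) * T := by rw [← hT]; ring
  have hVU : g ^ 4 - R ^ 2 = C (4 : ℤ) * (T * (g ^ 2 - T)) := by
    rw [hR', hC2, hC4]; ring
  have hVμ : ∀ μ ∈ primitiveRoots m ℂ, aeval μ (g ^ 4 - R ^ 2) = aeval μ g ^ 4 - aeval (μ ^ k) g ^ 2 := by
    intro μ hμ
    rw [map_sub, map_pow, map_pow, hR μ hμ]
  exact two_pow_totient_le_of_four_dvd_poly hm hkcop g _ _ hVU hVμ hsep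

/-- **Nondegeneracy from non-torsion** for the 2-adic inequality: with `g, R` as above (`R(μ) = g(μ^k)` on the primitive
`m`-th roots, `k` prime to `m`), if `g(ζ)` is neither `0` nor a root of unity then `g(μ)⁴ ≠ g(μ^k)²` for every
primitive `μ` (else `|g(ζ^{k^i})|² = |g(ζ)|^{2^{i+1}}` for all `i` and `k^{φ(m)} ≡ 1` force `g(ζ)^{2^{φ(m)+1}-2} = 1`).
[cite: BombieriGubler2001, Theorem 4.4.9 p.110 (Amoroso–Dvornicich: the 2-adic resultant inequalities for cyclotomic integers)] -/
theorem pow_four_ne_aeval_pow_sq_of_not_torsion {m k : ℕ} (hm : 0 < m) (hkcop : k.Coprime m) (g R : ℤ[X])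
    (hR : ∀ μ ∈ primitiveRoots m ℂ, aeval μ R = aeval (μ ^ k) g) {ζ : ℂ} (hζ : IsPrimitiveRoot ζ m)
    (h0 : aeval ζ g ≠ 0) (hnu : ∀ j : ℕ, 0 < j → aeval ζ g ^ j ≠ 1) :
    ∀ μ ∈ primitiveRoots m ℂ, aeval μ g ^ 4 ≠ aeval (μ ^ k) g ^ 2 := by
  intro μ hμ heq
  have hμ' := (mem_primitiveRoots hm).1 hμ
  set Q : ℤ[X] := g ^ 4 - R ^ 2 with hQ
  have hQμ : aeval μ Q = 0 := by
    rw [hQ, map_sub, map_pow, map_pow, hR μ hμ, heq, sub_self]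
  have hstep : ∀ ν : ℂ, IsPrimitiveRoot ν m → aeval ν g ^ 4 = aeval (ν ^ k) g ^ 2 := by
    intro ν hν
    have h := aeval_eq_zero_of_primitiveRoot hm hμ' hQμ hν
    rw [hQ, map_sub, map_pow, map_pow, hR ν ((mem_primitiveRoots hm).2 hν), sub_eq_zero] at h
    exact h
  -- `a_i = g(ζ^{k^i})` satisfies `a_i² = a_0^{2^{i+1}}`
  have hiter : ∀ i : ℕ, aeval (ζ ^ k ^ i) g ^ 2 = aeval ζ g ^ 2 ^ (i + 1) := by
    intro i
    induction i with
    | zero => simp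
    | succ i ih =>
      have hprim : IsPrimitiveRoot (ζ ^ k ^ i) m := hζ.pow_of_coprime _ (Nat.Coprime.pow_left i hkcop)
      have h := hstep _ hprim
      rw [← pow_mul, ← pow_succ] at h
      rw [← h, show (4 : ℕ) = 2 * 2 from rfl, pow_mul, ih, ← pow_mul, ← pow_succ]
  have hE : (k ^ m.totient) % m = 1 % m := Nat.ModEq.pow_totient hkcop
  have key := hiter m.totient
  rw [pow_eq_self_of_mod_eq hm hζ hE] at key
  -- `a_0² = a_0^{2^{φ+1}}`, so `a_0^{2^{φ+1} - 2} = 1`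
  have htot : 0 < m.totient := Nat.totient_pos.2 hm
  have hge : 4 ≤ 2 ^ (m.totient + 1) := by
    calc 4 = 2 ^ 2 := by norm_num
      _ ≤ 2 ^ (m.totient + 1) := Nat.pow_le_pow_right (by norm_num) (by omega)
  have hone : aeval ζ g ^ (2 ^ (m.totient + 1) - 2) = 1 := by
    have h2 : aeval ζ g ^ (2 ^ (m.totient + 1) - 2) * aeval ζ g ^ 2 = 1 * aeval ζ g ^ 2 := by
      rw [← pow_add, Nat.sub_add_cancel (by omega), ← key, one_mul]
    exact mul_right_cancel₀ (pow_ne_zero _ h0) h2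
  exact hnu _ (by omega) hone

/-- `g² - g(X²) = 2 T` (Frobenius at `2`).
[cite: BombieriGubler2001, Theorem 4.4.9 p.110 (Amoroso–Dvornicich: the 2-adic resultant inequalities for cyclotomic integers)] -/
theorem exists_sq_sub_expand_two (g : ℤ[X]) : ∃ T : ℤ[X], g ^ 2 - expand ℤ 2 g = C (2 : ℤ) * T := by
  obtain ⟨T, hT⟩ := exists_pow_sub_expand_eq_prime_mul g Nat.prime_two
  exact ⟨T, by exact_mod_cast hT⟩

/-- `g(X) - g(-X) = 2 O` (the odd part).
[cite: BombieriGubler2001, Theorem 4.4.9 p.110 (Amoroso–Dvornicich: the 2-adic resultant inequalities for cyclotomic integers)] -/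
theorem exists_sub_comp_neg_X (g : ℤ[X]) : ∃ O : ℤ[X], g - g.comp (-X) = C (2 : ℤ) * O := by
  induction g using Polynomial.induction_on' with
  | add f h hf hh =>
    obtain ⟨O₁, h₁⟩ := hf
    obtain ⟨O₂, h₂⟩ := hh
    refine ⟨O₁ + O₂, ?_⟩
    rw [add_comp, show f + h - (f.comp (-X) + h.comp (-X)) = (f - f.comp (-X)) + (h - h.comp (-X)) by ring, h₁, h₂]
    ring
  | monomial i a =>
    have hC2 : (C (2 : ℤ) : ℤ[X]) = 2 := by simp
    rcases Nat.even_or_odd i with hi | hi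
    · refine ⟨0, ?_⟩
      rw [← C_mul_X_pow_eq_monomial, mul_comp, C_comp, X_pow_comp, hi.neg_pow, mul_zero, sub_self]
    · refine ⟨C a * X ^ i, ?_⟩
      rw [← C_mul_X_pow_eq_monomial, mul_comp, C_comp, X_pow_comp, hi.neg_pow, hC2]
      ring

/-- **`m` odd: `2^{φ(m)} ≤ (∏_μ max(1,|g(μ)|))^6`** for `g(ζ_m) ≠ 0` not a root of unity (`σ: ζ ↦ ζ²`).
[cite: BombieriGubler2001, Theorem 4.4.9 p.110 (Amoroso–Dvornicich: the 2-adic resultant inequalities for cyclotomic integers)] -/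
theorem two_pow_totient_le_of_odd {m : ℕ} (hm : 0 < m) (hodd : ¬ 2 ∣ m) (g : ℤ[X]) {ζ : ℂ} (hζ : IsPrimitiveRoot ζ m)
    (h0 : aeval ζ g ≠ 0) (hnu : ∀ j : ℕ, 0 < j → aeval ζ g ^ j ≠ 1) :
    (2 : ℝ) ^ m.totient ≤ (∏ μ ∈ primitiveRoots m ℂ, max 1 ‖aeval μ g‖) ^ 6 := by
  have hkcop : (2 : ℕ).Coprime m := (Nat.Prime.coprime_iff_not_dvd Nat.prime_two).2 hodd
  obtain ⟨T, hT⟩ := exists_sq_sub_expand_two g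
  have hR : ∀ μ ∈ primitiveRoots m ℂ, aeval μ (expand ℤ 2 g) = aeval (μ ^ 2) g := fun μ _ => expand_aeval 2 g μ
  exact two_pow_totient_le_of_sq_congr hm hkcop g _ T hT hR
    (pow_four_ne_aeval_pow_sq_of_not_torsion hm hkcop g _ hR hζ h0 hnu)

/-- **`m ≡ 2 (mod 4)`: `2^{φ(m)} ≤ (∏_μ max(1,|g(μ)|))^6`** for `g(ζ_m) ≠ 0` not a root of unity (`σ: ζ ↦ ζ^{2+m/2} = -ζ²`;
`g² - g(-X²) = (g² - g(X²)) + (g(X²) - g(-X²)) ≡ 0 (mod 2)`).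
[cite: BombieriGubler2001, Theorem 4.4.9 p.110 (Amoroso–Dvornicich: the 2-adic resultant inequalities for cyclotomic integers)] -/
theorem two_pow_totient_le_of_two_mod_four {m : ℕ} (hm : 0 < m) (h2 : 2 ∣ m) (h4 : ¬ 4 ∣ m) (g : ℤ[X]) {ζ : ℂ}
    (hζ : IsPrimitiveRoot ζ m) (h0 : aeval ζ g ≠ 0) (hnu : ∀ j : ℕ, 0 < j → aeval ζ g ^ j ≠ 1) :
    (2 : ℝ) ^ m.totient ≤ (∏ μ ∈ primitiveRoots m ℂ, max 1 ‖aeval μ g‖) ^ 6 := by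
  obtain ⟨n, hn⟩ := h2
  have hnodd : ¬ 2 ∣ n := by
    intro h; apply h4; obtain ⟨q, hq⟩ := h; exact ⟨q, by rw [hn, hq]; ring⟩
  have hn0 : 0 < n := by
    rcases Nat.eq_zero_or_pos n with h | h
    · rw [h, mul_zero] at hn; omega
    · exact h
  set k : ℕ := 2 + n with hk
  have hkcop : k.Coprime m := by
    rw [hn, hk]
    refine Nat.Coprime.mul_right ?_ ?_
    · exact ((Nat.Prime.coprime_iff_not_dvd Nat.prime_two).2
        (fun h => hnodd ((Nat.dvd_add_right (dvd_refl 2)).1 h))).symm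
    · rw [show 2 + n = 2 + 1 * n by ring, Nat.coprime_add_mul_right_left]
      exact (Nat.Prime.coprime_iff_not_dvd Nat.prime_two).2 hnodd
  -- `R = (g ∘ (-X))(X²)`
  obtain ⟨T₁, hT₁⟩ := exists_sq_sub_expand_two g
  obtain ⟨O, hO⟩ := exists_sub_comp_neg_X g
  set R : ℤ[X] := expand ℤ 2 (g.comp (-X)) with hRdef
  have hT : g ^ 2 - R = C (2 : ℤ) * (T₁ + expand ℤ 2 O) := by
    have h1 : g ^ 2 - R = (g ^ 2 - expand ℤ 2 g) + expand ℤ 2 (g - g.comp (-X)) := by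
      rw [hRdef, map_sub]; ring
    rw [h1, hT₁, hO, map_mul, expand_C]; ring
  have hR : ∀ μ ∈ primitiveRoots m ℂ, aeval μ R = aeval (μ ^ k) g := by
    intro μ hμ
    have hμ' := (mem_primitiveRoots hm).1 hμ
    have hhalf : μ ^ n = -1 := by
      have h2 : IsPrimitiveRoot (μ ^ n) 2 := hμ'.pow hm (by rw [hn, mul_comm])
      exact h2.eq_neg_one_of_two_right
    have hμk : μ ^ k = -(μ ^ 2) := by rw [hk, pow_add, hhalf]; ring
    rw [hRdef, expand_aeval, aeval_comp, map_neg, aeval_X, hμk]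
  exact two_pow_totient_le_of_sq_congr hm hkcop g R _ hT hR
    (pow_four_ne_aeval_pow_sq_of_not_torsion hm hkcop g R hR hζ h0 hnu)

/-- `1 + m/2` is prime to `m` when `4 ∣ m`.
[cite: BombieriGubler2001, Theorem 4.4.9 p.110 (Amoroso–Dvornicich: the 2-adic resultant inequalities for cyclotomic integers)] -/
theorem coprime_one_add_half {m : ℕ} (h4 : 4 ∣ m) : (1 + m / 2).Coprime m := by
  obtain ⟨q, hq⟩ := h4
  have hhalf : m / 2 = 2 * q := by rw [hq, show 4 * q = 2 * (2 * q) by ring, Nat.mul_div_cancel_left _ (by norm_num)]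
  rw [hhalf, hq, show 4 * q = 2 ^ 2 * q by norm_num]
  refine Nat.Coprime.mul_right (Nat.Coprime.pow_right 2 ?_) ?_
  · exact ((Nat.Prime.coprime_iff_not_dvd Nat.prime_two).2 (by omega)).symm
  · rw [show 1 + 2 * q = 1 + q * 2 by ring, Nat.coprime_add_mul_left_left]
    exact Nat.coprime_one_left q

/-- For `4 ∣ m` (indeed `2 ∣ m`) and `μ` a primitive `m`-th root of unity: `μ^{1+m/2} = -μ`.
[cite: BombieriGubler2001, Theorem 4.4.9 p.110 (Amoroso–Dvornicich: the 2-adic resultant inequalities for cyclotomic integers)] -/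
theorem pow_one_add_half_eq_neg {m : ℕ} (hm : 0 < m) (h2 : 2 ∣ m) {μ : ℂ} (hμ : IsPrimitiveRoot μ m) :
    μ ^ (1 + m / 2) = -μ := by
  have hhalf : IsPrimitiveRoot (μ ^ (m / 2)) 2 := hμ.pow hm (Nat.div_mul_cancel h2).symm
  rw [pow_add, pow_one, hhalf.eq_neg_one_of_two_right]; ring

/-- **`4 ∣ m`, nondegenerate case: `2^{φ(m)} ≤ (∏_μ max(1,|g(μ)|))^4`** ([Amoroso–Dvornicich 2000, Lemma 3 (2) /
Proposition 2 (1)] in kernel form, `h(α) ≥ log 2/4`): `g(X)² - g(-X)² = 4·O·(g - O)` with `g - g(-X) = 2O`, and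
`∏_μ (g(μ)² - g(-μ)²) = Res(Φ_m, ·)` is then a nonzero multiple of `4^{φ(m)}` of modulus `≤ 2^{φ(m)} H² H²`.
[cite: BombieriGubler2001, Theorem 4.4.9 p.110 (Amoroso–Dvornicich: the 2-adic resultant inequalities for cyclotomic integers)] -/
theorem two_pow_totient_le_of_four_dvd {m : ℕ} (hm : 0 < m) (h4 : 4 ∣ m) (g : ℤ[X])
    (hsep : ∀ μ ∈ primitiveRoots m ℂ, aeval μ g ^ 2 ≠ aeval (μ ^ (1 + m / 2)) g ^ 2) :
    (2 : ℝ) ^ m.totient ≤ (∏ μ ∈ primitiveRoots m ℂ, max 1 ‖aeval μ g‖) ^ 4 := by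
  have h2 : 2 ∣ m := dvd_trans (by norm_num) h4
  obtain ⟨O, hO⟩ := exists_sub_comp_neg_X g
  have hC2 : (C (2 : ℤ) : ℤ[X]) = 2 := by simp
  have hC4 : (C (4 : ℤ) : ℤ[X]) = 4 := by simp
  have hneg : g.comp (-X) = g - C (2 : ℤ) * O := by rw [← hO]; ring
  have hVU : g ^ 2 - (g.comp (-X)) ^ 2 = C (4 : ℤ) * (O * (g - O)) := by
    rw [hneg, hC2, hC4]; ring
  have hVμ : ∀ μ ∈ primitiveRoots m ℂ,
      aeval μ (g ^ 2 - (g.comp (-X)) ^ 2) = aeval μ g ^ 2 - aeval (μ ^ (1 + m / 2)) g ^ 2 := by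
    intro μ hμ
    rw [map_sub, map_pow, map_pow, aeval_comp, map_neg, aeval_X,
      pow_one_add_half_eq_neg hm h2 ((mem_primitiveRoots hm).1 hμ)]
  exact two_pow_totient_le_of_four_dvd_poly hm (coprime_one_add_half h4) g _ _ hVU hVμ hsep

end Literature.NumberTheory.MahlerMeasure

end Part4

/-!
## Part 5 — port of `Summits/Ventures/DiscreteObjects/Mahler/CyclotomicIntegerProdBoundTwo.lean` (1 declarations kept)

# `2^{φ(m)} ≤ (∏_μ max(1,|g(μ)|))^6` for every conductor: the 2-adic induction (venture `DiscreteObjects`, target L)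

Cell `pub-namedobj`, seat `pub-namedobj-mahler-g28`. Framing: lottery ticket; floor = certified bounds/negative ranges.

F. Amoroso, R. Dvornicich, J. Number Theory 80 (2000), proof of Proposition 2 (the prime `2`; Lemma 3), assembled for ALL
conductors `m` by strong induction on `m` (degenerate case: twist + explicit descent `CyclotomicIntegerDescent` + fibre
transfer `CyclotomicIntegerTwistFibre`, as in `CyclotomicIntegerLehmerAll` for [cite: BombieriGubler2001, Theorem 4.4.9]):
**for every `m ≥ 1`, every primitive `m`-th root of unity `ζ` and every `g ∈ ℤ[X]` with `g(ζ) ≠ 0` not a root of unity,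
`2^{φ(m)} ≤ (∏_μ max(1,|g(μ)|))^6`** over the primitive `m`-th roots of unity (`cyclotomicInteger_prod_bound_two`).  The
Mahler-measure form `2^{deg α} ≤ M(α)^6` (`h(α) ≥ (log 2)/6`) is in `CyclotomicIntegerLehmerTwo`.  REPLICATION of the
published method with the trivial archimedean estimate; no new mathematics claimed.
-/

section Part5

namespace Literature.NumberTheory.MahlerMeasure

open _root_.Polynomial _root_.Finset

/-- **`2^{φ(m)} ≤ (∏_μ max(1,|g(μ)|))^6` for EVERY conductor `m`** and every `g ∈ ℤ[X]` with `g(ζ_m) ≠ 0` not a root of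
unity (Amoroso–Dvornicich's 2-adic argument with the trivial archimedean estimate; strong induction on `m`): `4 ∤ m`
directly (`CyclotomicIntegerTwoAdic`); `4 ∣ m`, `m = 2n`: with `σ : ζ ↦ -ζ` either `g(μ)² ≠ g(-μ)²` for all `μ` (bound
`H^4 ≤ H^6`) or a twist `ζ^a g(ζ)` is `σ`-invariant (`exists_twist_invariant`), equals `(contract₂ (X^a g))(ζ²)`
(`aeval_eq_aeval_contract_of_invariant`), and the induction hypothesis at `n` applies (`prod_primitiveRoots_pow_prime_eq`).
[cite: BombieriGubler2001, Theorem 4.4.9 p.110 (Amoroso–Dvornicich, p = 2: 2^{φ(m)} ≤ (∏_μ max(1,|g(μ)|))⁶)] -/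
theorem cyclotomicInteger_prod_bound_two (m : ℕ) : 0 < m → ∀ (g : ℤ[X]) (ζ : ℂ), IsPrimitiveRoot ζ m →
    aeval ζ g ≠ 0 → (∀ j : ℕ, 0 < j → aeval ζ g ^ j ≠ 1) →
    (2 : ℝ) ^ m.totient ≤ (∏ μ ∈ primitiveRoots m ℂ, max 1 ‖aeval μ g‖) ^ 6 := by
  induction m using Nat.strong_induction_on with
  | _ m ih =>
  intro hm0 g ζ hζ h0 hnu
  have hH1 : 1 ≤ ∏ μ ∈ primitiveRoots m ℂ, max 1 ‖aeval μ g‖ :=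
    Finset.prod_induction _ (fun x : ℝ => 1 ≤ x) (fun _ _ ha hb => one_le_mul_of_one_le_of_one_le ha hb) le_rfl
      (fun _ _ => le_max_left _ _)
  have hp2 : Nat.Prime 2 := Nat.prime_two
  by_cases h4 : 4 ∣ m
  · -- `m = 2 n` with `2 ∣ n`
    obtain ⟨q, hq⟩ := h4
    set n : ℕ := 2 * q with hndef
    have hmn : m = 2 * n := by rw [hq, hndef]; ring
    have h2n : 2 ∣ n := ⟨q, hndef⟩
    have hn : 0 < n := by
      rcases Nat.eq_zero_or_pos n with h | h
      · rw [h, mul_zero] at hmn; omega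
      · exact h
    have hnm : n < m := by omega
    have hhalf : m / 2 = n := by rw [hmn, Nat.mul_div_cancel_left n (by norm_num : 0 < 2)]
    by_cases hdeg : ∃ μ ∈ primitiveRoots m ℂ, aeval μ g ^ 2 = aeval (μ ^ (1 + n)) g ^ 2
    · -- degenerate case: twist, descend to `ζ²`, induct
      have hdeg' : aeval (ζ ^ (1 + n)) g ^ 2 = aeval ζ g ^ 2 := aeval_pow_pow_eq_of_exists hm0 g hζ hdeg
      obtain ⟨a, hinv⟩ := exists_twist_invariant hm0 hp2 hmn (k := 1 + n) (s := 1) (by ring) (by omega) g hζ h0 hdeg'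
      have hdesc := aeval_eq_aeval_contract_of_invariant hm0 hp2 hmn h2n (t := 1) (by omega) (X ^ a * g) hζ
        (fun μ hμ => by rw [mul_one]; exact hinv μ hμ)
      set G : ℤ[X] := contract 2 (X ^ a * g) with hGdef
      have hθ : IsPrimitiveRoot (ζ ^ 2) n := hζ.pow hm0 hmn
      have hζ0 : ζ ≠ 0 := hζ.ne_zero hm0.ne'
      have hval : aeval (ζ ^ 2) G = ζ ^ a * aeval ζ g := by rw [← hdesc, map_mul, map_pow, aeval_X]
      have hG0 : aeval (ζ ^ 2) G ≠ 0 := by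
        rw [hval]; exact mul_ne_zero (pow_ne_zero _ hζ0) h0
      have hGnu : ∀ j : ℕ, 0 < j → aeval (ζ ^ 2) G ^ j ≠ 1 := by
        intro j hj hj1
        apply hnu (j * m) (Nat.mul_pos hj hm0)
        have h1 : (ζ ^ a * aeval ζ g) ^ (j * m) = 1 := by rw [← hval, pow_mul, hj1, one_pow]
        rw [mul_pow, ← pow_mul, show a * (j * m) = m * (a * j) by ring, pow_mul, hζ.pow_eq_one, one_pow,
          one_mul] at h1
        exact h1
      have hIH := ih n hnm hn G (ζ ^ 2) hθ hG0 hGnu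
      have hall : ∀ μ ∈ primitiveRoots m ℂ, aeval μ (X ^ a * g) = aeval (μ ^ 2) G := by
        intro μ hμ
        have hμ' := (mem_primitiveRoots hm0).1 hμ
        set Q : ℤ[X] := X ^ a * g - expand ℤ 2 G with hQ
        have hQζ : aeval ζ Q = 0 := by rw [hQ, map_sub, expand_aeval, hdesc, sub_self]
        have hQμ := aeval_eq_zero_of_primitiveRoot hm0 hζ hQζ hμ'
        rwa [hQ, map_sub, expand_aeval, sub_eq_zero] at hQμ
      have hH : ∏ μ ∈ primitiveRoots m ℂ, max 1 ‖aeval μ g‖ =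
          ∏ μ ∈ primitiveRoots m ℂ, max 1 ‖aeval (μ ^ 2) G‖ := by
        refine Finset.prod_congr rfl fun μ hμ => ?_
        rw [← hall μ hμ, map_mul, map_pow, aeval_X, norm_mul, norm_pow,
          ((mem_primitiveRoots hm0).1 hμ).norm'_eq_one hm0.ne', one_pow, one_mul]
      have he : m.totient = 2 * n.totient := by rw [hmn, Nat.totient_mul_of_prime_of_dvd hp2 h2n]
      have hfib : ∏ μ ∈ primitiveRoots m ℂ, max 1 ‖aeval (μ ^ 2) G‖ =
          (∏ θ ∈ primitiveRoots n ℂ, max 1 ‖aeval θ G‖) ^ 2 :=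
        prod_primitiveRoots_pow_prime_eq hm0 hp2 hmn hn he (fun z => max 1 ‖aeval z G‖)
      have hR : ((∏ θ ∈ primitiveRoots n ℂ, max 1 ‖aeval θ G‖) ^ 2) ^ 6 =
          ((∏ θ ∈ primitiveRoots n ℂ, max 1 ‖aeval θ G‖) ^ 6) ^ 2 := by
        rw [← pow_mul, ← pow_mul, mul_comm]
      rw [hH, hfib, hR, he, mul_comm 2, pow_mul]
      exact pow_le_pow_left₀ (by positivity) hIH 2
    · -- nondegenerate case
      have hsep : ∀ μ ∈ primitiveRoots m ℂ, aeval μ g ^ 2 ≠ aeval (μ ^ (1 + m / 2)) g ^ 2 := by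
        intro μ hμ heq
        rw [hhalf] at heq
        exact hdeg ⟨μ, hμ, heq⟩
      exact (two_pow_totient_le_of_four_dvd hm0 ⟨q, hq⟩ g hsep).trans (pow_le_pow_right₀ hH1 (by norm_num))
  · by_cases h2 : 2 ∣ m
    · exact two_pow_totient_le_of_two_mod_four hm0 h2 h4 g hζ h0 hnu
    · exact two_pow_totient_le_of_odd hm0 h2 g hζ h0 hnu

end Literature.NumberTheory.MahlerMeasure

end Part5

/-!
## Part 6 — port of `Summits/Ventures/DiscreteObjects/Mahler/CyclotomicIntegerLehmerTwo.lean` (1 declarations kept)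

# `2^{deg α} ≤ M(α)^6` for every cyclotomic integer: Lehmer for abelian integers with Amoroso–Dvornicich's 2-adic constant (venture `DiscreteObjects`, target L)

Cell `pub-namedobj`, seat `pub-namedobj-mahler-g28`. Framing: lottery ticket; floor = certified bounds/negative ranges.

F. Amoroso, R. Dvornicich, J. Number Theory 80 (2000), proof of Proposition 2 (the prime `2`; Lemma 3), assembled for ALL
conductors `m` by strong induction (degenerate case: twist + explicit descent `CyclotomicIntegerDescent` + fibre transfer
`CyclotomicIntegerTwistFibre`, exactly as in `CyclotomicIntegerLehmerAll` for [cite: BombieriGubler2001, Theorem 4.4.9]):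
**for every `m ≥ 1`, every primitive `m`-th root of unity `ζ ∈ ℂ` and every `g ∈ ℤ[X]` with `α = g(ζ) ≠ 0` not a root of
unity, `2^{deg α} ≤ M(α)^6`** (`cyclotomicInteger_lehmer_bound_two`), i.e. `h(α) ≥ (log 2)/6 = 0.1155…` — sharper than
the `log(5/2)/10 = 0.0916…` of `CyclotomicIntegerLehmerAll` (the published optimum of the method, `(log 5)/12 = 0.1341…`,
needs A–D's archimedean Lemma 4 and is not reproduced).  Corollaries: `M(α) ≥ 2^{1/3} = 1.2599…` in degree `≥ 2`
(`two_le_measure_pow_three`); every such `α` has a conjugate of modulus `≥ 2^{1/6} = 1.1224…` (`exists_conjugate_norm_pow_six_ge_two`).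
REPLICATION of the published method (with the trivial archimedean estimate); no new mathematics claimed.
-/

section Part6

namespace Literature.NumberTheory.MahlerMeasure

open _root_.Polynomial _root_.Finset

/-- **`2^{deg α} ≤ M(α)^6` for every nonzero non-torsion cyclotomic integer `α = g(ζ_m)`, every conductor `m`**
(`h(α) ≥ (log 2)/6 = 0.1155…`; Amoroso–Dvornicich's 2-adic method with the trivial archimedean estimate — their theorem
has `(log 5)/12`; [cite: BombieriGubler2001, Theorem 4.4.9] has `log(5/2)/10 = 0.0916…`, `CyclotomicIntegerLehmerAll`). -/
theorem cyclotomicInteger_lehmer_bound_two {m : ℕ} (hm : 0 < m) (g : ℤ[X]) {ζ : ℂ} (hζ : IsPrimitiveRoot ζ m)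
    (h0 : aeval ζ g ≠ 0) (hnu : ∀ k : ℕ, 0 < k → aeval ζ g ^ k ≠ 1) :
    (2 : ℝ) ^ (minpoly ℤ (aeval ζ g)).natDegree ≤ intMahlerMeasure (minpoly ℤ (aeval ζ g)) ^ 6 := by
  obtain ⟨e, he0, hed, hprod⟩ := exists_prod_max_eq_measure_pow hm g hζ
  have hB := cyclotomicInteger_prod_bound_two m hm g ζ hζ h0 hnu
  set M := intMahlerMeasure (minpoly ℤ (aeval ζ g)) with hM
  set d := (minpoly ℤ (aeval ζ g)).natDegree with hd
  have hR : (M ^ e) ^ 6 = (M ^ 6) ^ e := by rw [← pow_mul, ← pow_mul, mul_comm]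
  rw [hprod, ← hed, hR, mul_comm e d, pow_mul] at hB
  have hζint : IsIntegral ℤ ζ := hζ.isIntegral hm
  have hαint : IsIntegral ℤ (aeval ζ g) := by
    have hmem : aeval ζ g ∈ Algebra.adjoin ℤ {ζ} := Polynomial.aeval_mem_adjoin_singleton ℤ ζ
    exact (mem_integralClosure_iff ℤ ℂ).1 (adjoin_le_integralClosure hζint hmem)
  have hM0 : 0 ≤ M := le_trans zero_le_one (one_le_intMahlerMeasure (minpoly.monic hαint).ne_zero)
  exact (pow_le_pow_iff_left₀ (by positivity) (by positivity) he0).1 hB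

end Literature.NumberTheory.MahlerMeasure

end Part6

/-!
## Part 7 — port of `Summits/Ventures/DiscreteObjects/Mahler/CyclotomicFieldIntegersSchinzel.lean` (2 declarations kept)

# Schinzel's bound for the ring of integers of every cyclotomic field (venture `DiscreteObjects`, target L)

Cell `pub-namedobj`, seat `pub-namedobj-mahler-g28`. Framing: lottery ticket; floor = certified bounds/negative ranges.

The presentation-free forms (`α` any algebraic integer of `ℚ(ζ_m) ⊂ ℂ`, via `𝓞_{ℚ(ζ_m)} = ℤ[ζ_m]`,
`CyclotomicFieldIntegersLehmer.exists_aeval_eq_of_isIntegral_of_mem_adjoin`) of the bounds landed for `α = g(ζ_m)`: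
Schinzel 1973 (CM case) **`φ^{deg α} ≤ M(α)²`** and `M(α) ≥ φ` in degree `≥ 2` (`CyclotomicIntegerSchinzelMeasure`), and the
2-adic bound `2^{deg α} ≤ M(α)^6` (`CyclotomicIntegerLehmerTwo`; Amoroso–Dvornicich), next to [cite: BombieriGubler2001,
Theorem 4.4.9] (`lehmer_of_isIntegral_mem_cyclotomicField`).  Bookkeeping; no new mathematics.
-/

section Part7

namespace Literature.NumberTheory.MahlerMeasure

open _root_.Polynomial

/-- **Schinzel's theorem for the algebraic integers of a cyclotomic field**: `α ∈ ℚ(ζ_m)` an algebraic integer, `α ≠ 0`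
not a root of unity ⇒ `φ^{deg α} ≤ M(α)²`, and `φ ≤ M(α)` when `deg α ≥ 2`.
[cite: Schinzel1973, Acta Arith. 24; see MckeeSmyth2021 Exercise 14.11 p.231 and BombieriGubler2001, Theorem 4.4.9 p.110 — for integers of cyclotomic fields: φ^{deg α} ≤ M(α)² and 2^{deg α} ≤ M(α)⁶] -/
theorem schinzel_of_isIntegral_mem_cyclotomicField {m : ℕ} (hm : 0 < m) {ζ : ℂ} (hζ : IsPrimitiveRoot ζ m) {α : ℂ}
    (hα : α ∈ IntermediateField.adjoin ℚ {ζ}) (hint : IsIntegral ℤ α) (h0 : α ≠ 0)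
    (hnu : ∀ k : ℕ, 0 < k → α ^ k ≠ 1) :
    Real.goldenRatio ^ (minpoly ℤ α).natDegree ≤ intMahlerMeasure (minpoly ℤ α) ^ 2 ∧
      (2 ≤ (minpoly ℤ α).natDegree → Real.goldenRatio ≤ intMahlerMeasure (minpoly ℤ α)) := by
  obtain ⟨g, rfl⟩ := exists_aeval_eq_of_isIntegral_of_mem_adjoin hm hζ hα hint
  exact ⟨goldenRatio_pow_le_measure_sq hm g hζ h0 hnu, fun hd => goldenRatio_le_measure hm g hζ h0 hnu hd⟩

/-- The 2-adic bound for the algebraic integers of a cyclotomic field: `2^{deg α} ≤ M(α)^6`.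
[cite: Schinzel1973, Acta Arith. 24; see MckeeSmyth2021 Exercise 14.11 p.231 and BombieriGubler2001, Theorem 4.4.9 p.110 — for integers of cyclotomic fields: φ^{deg α} ≤ M(α)² and 2^{deg α} ≤ M(α)⁶] -/
theorem two_pow_le_measure_pow_six_of_isIntegral_mem_cyclotomicField {m : ℕ} (hm : 0 < m) {ζ : ℂ}
    (hζ : IsPrimitiveRoot ζ m) {α : ℂ} (hα : α ∈ IntermediateField.adjoin ℚ {ζ}) (hint : IsIntegral ℤ α) (h0 : α ≠ 0)
    (hnu : ∀ k : ℕ, 0 < k → α ^ k ≠ 1) :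
    (2 : ℝ) ^ (minpoly ℤ α).natDegree ≤ intMahlerMeasure (minpoly ℤ α) ^ 6 := by
  obtain ⟨g, rfl⟩ := exists_aeval_eq_of_isIntegral_of_mem_adjoin hm hζ hα hint
  exact cyclotomicInteger_lehmer_bound_two hm g hζ h0 hnu

end Literature.NumberTheory.MahlerMeasure

end Part7

/-!
## Part 8 — port of `Summits/Ventures/DiscreteObjects/Mahler/CyclotomicIntegerSchinzelSharp.lean` (3 declarations kept)

# Sharpness of Schinzel's bound for cyclotomic integers: `α = 1 + ζ₅ + ζ₅⁴ = φ` (venture `DiscreteObjects`, target L)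

Cell `pub-namedobj`, seat `pub-namedobj-mahler-g28`. Framing: lottery ticket; floor = certified bounds/negative ranges.

Companion of `CyclotomicIntegerSchinzel` / `CyclotomicIntegerSchinzelMeasure` (Schinzel 1973: `φ^{deg α} ≤ M(α)²` for every
nonzero non-torsion cyclotomic integer): the bound is an EQUALITY for the cyclotomic integer `α = 1 + ζ₅ + ζ₅⁴ ∈ ℤ[ζ₅]`
(`= 1 + 2cos(2π/5) = φ`): `minpoly_ℤ α = x² - x - 1` (`minpoly_one_add_zeta_five`: `α² - α - 1 = Φ₅(ζ)·(…) = 0`, and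
`x² - x - 1` has no integer root by parity), `M(x² - x - 1) = φ` (`GoldenRatioSharpness`; [cite: MckeeSmyth2021, Exercise 14.11] for
Schinzel's theorem), so `M(α)² = φ² = φ^{deg α}` (`schinzel_cyclotomicInteger_sharp`).  Bookkeeping; no new mathematics.
-/

section Part8

namespace Literature.NumberTheory.MahlerMeasure

open _root_.Polynomial

/-- `α = 1 + ζ + ζ⁴` for a primitive fifth root of unity `ζ` satisfies `α² - α - 1 = 0` (it is the golden ratio or its
conjugate).
[cite: Schinzel1973, Acta Arith. 24; see MckeeSmyth2021 Exercise 14.11 p.231 (sharpness: α = 1 + ζ₅ + ζ₅⁴ = φ has M(α)² = φ^{deg α})] -/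
theorem aeval_goldenPoly_one_add_zeta_five {ζ : ℂ} (hζ : IsPrimitiveRoot ζ 5) :
    aeval (aeval ζ (1 + X + X ^ 4 : ℤ[X])) (X ^ 2 - X - 1 : ℤ[X]) = 0 := by
  have h5 : ζ ^ 5 = 1 := hζ.pow_eq_one
  have hsum : 1 + ζ + ζ ^ 2 + ζ ^ 3 + ζ ^ 4 = 0 := by
    have h := hζ.geom_sum_eq_zero (by norm_num : 1 < 5)
    simpa [Finset.sum_range_succ, pow_succ] using h
  simp only [map_add, map_sub, map_pow, map_one, aeval_X]
  have h8 : ζ ^ 8 = ζ ^ 3 := by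
    calc ζ ^ 8 = ζ ^ 5 * ζ ^ 3 := by ring
      _ = ζ ^ 3 := by rw [h5, one_mul]
  have e : (1 + ζ + ζ ^ 4) ^ 2 - (1 + ζ + ζ ^ 4) - 1 =
      (1 + ζ + ζ ^ 2 + ζ ^ 3 + ζ ^ 4) + (ζ ^ 8 - ζ ^ 3) + 2 * (ζ ^ 5 - 1) := by ring
  rw [e, hsum, h8, h5]; ring

/-- The minimal polynomial of `1 + ζ₅ + ζ₅⁴` is `x² - x - 1`.
[cite: Schinzel1973, Acta Arith. 24; see MckeeSmyth2021 Exercise 14.11 p.231 (sharpness: α = 1 + ζ₅ + ζ₅⁴ = φ has M(α)² = φ^{deg α})] -/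
theorem minpoly_one_add_zeta_five {ζ : ℂ} (hζ : IsPrimitiveRoot ζ 5) :
    minpoly ℤ (aeval ζ (1 + X + X ^ 4 : ℤ[X])) = X ^ 2 - X - 1 := by
  set α : ℂ := aeval ζ (1 + X + X ^ 4 : ℤ[X]) with hα
  have hζint : IsIntegral ℤ ζ := hζ.isIntegral (by norm_num)
  have hαint : IsIntegral ℤ α := by
    have hmem : α ∈ Algebra.adjoin ℤ {ζ} := Polynomial.aeval_mem_adjoin_singleton ℤ ζ
    exact (mem_integralClosure_iff ℤ ℂ).1 (adjoin_le_integralClosure hζint hmem)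
  set P : ℤ[X] := X ^ 2 - X - 1 with hP
  have hPmon : P.Monic := by
    rw [hP, show (X ^ 2 - X - 1 : ℤ[X]) = X ^ 2 - (X + 1) by ring]
    exact monic_X_pow_sub (by
      calc (X + 1 : ℤ[X]).degree ≤ 1 := by compute_degree
        _ < 2 := by norm_num)
  have hPdeg : P.natDegree = 2 := by rw [hP]; compute_degree!
  have hdvd : minpoly ℤ α ∣ P := minpoly.isIntegrallyClosed_dvd hαint (aeval_goldenPoly_one_add_zeta_five hζ)
  have hmon : (minpoly ℤ α).Monic := minpoly.monic hαint
  -- the degree of the minimal polynomial is `2`: it is `≤ 2` and not `1` (no integer root of `x² - x - 1`)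
  have hle : (minpoly ℤ α).natDegree ≤ 2 := hPdeg ▸ natDegree_le_of_dvd hdvd hPmon.ne_zero
  have hpos : 0 < (minpoly ℤ α).natDegree := minpoly.natDegree_pos hαint
  have hne1 : (minpoly ℤ α).natDegree ≠ 1 := by
    intro h1
    have hf1 := hmon.eq_X_add_C h1
    set c : ℤ := (minpoly ℤ α).coeff 0 with hc
    have hαc : α = -(c : ℂ) := by
      have h := minpoly.aeval ℤ α
      rw [hf1, map_add, aeval_X, aeval_C, algebraMap_int_eq, eq_intCast] at h
      linear_combination h
    have hroot := aeval_goldenPoly_one_add_zeta_five hζ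
    rw [← hα, hαc] at hroot
    simp only [map_sub, map_pow, map_one, aeval_X] at hroot
    have hint : ((c ^ 2 + c - 1 : ℤ) : ℂ) = 0 := by push_cast; linear_combination hroot
    have hc0 : c ^ 2 + c - 1 = 0 := by exact_mod_cast hint
    have hev : Even (c * (c + 1)) := Int.even_mul_succ_self c
    rcases hev with ⟨r, hr⟩
    have h2 : c * (c + 1) = 1 := by linear_combination hc0
    rw [h2] at hr
    omega
  have hdeg : (minpoly ℤ α).natDegree = 2 := by omega
  exact (eq_of_monic_of_dvd_of_natDegree_le hmon hPmon hdvd (by rw [hPdeg, hdeg])).symm ▸ rfl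

/-- **Schinzel's bound for cyclotomic integers is sharp**: for `α = 1 + ζ₅ + ζ₅⁴ = φ ∈ ℤ[ζ₅]` (nonzero, not a root of
unity, degree `2`) one has `M(α)² = φ² = φ^{deg α}`.
[cite: Schinzel1973, Acta Arith. 24; see MckeeSmyth2021 Exercise 14.11 p.231 (sharpness: α = 1 + ζ₅ + ζ₅⁴ = φ has M(α)² = φ^{deg α})] -/
theorem schinzel_cyclotomicInteger_sharp {ζ : ℂ} (hζ : IsPrimitiveRoot ζ 5) :
    aeval ζ (1 + X + X ^ 4 : ℤ[X]) ≠ 0 ∧ (∀ k : ℕ, 0 < k → aeval ζ (1 + X + X ^ 4 : ℤ[X]) ^ k ≠ 1) ∧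
      (minpoly ℤ (aeval ζ (1 + X + X ^ 4 : ℤ[X]))).natDegree = 2 ∧
      intMahlerMeasure (minpoly ℤ (aeval ζ (1 + X + X ^ 4 : ℤ[X]))) ^ 2 =
        Real.goldenRatio ^ (minpoly ℤ (aeval ζ (1 + X + X ^ 4 : ℤ[X]))).natDegree := by
  have hmin := minpoly_one_add_zeta_five hζ
  have hdeg : (minpoly ℤ (aeval ζ (1 + X + X ^ 4 : ℤ[X]))).natDegree = 2 := by rw [hmin]; compute_degree!
  have hM : intMahlerMeasure (minpoly ℤ (aeval ζ (1 + X + X ^ 4 : ℤ[X]))) = Real.goldenRatio := by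
    rw [hmin]; exact intMahlerMeasure_X_sq_sub_X_sub_one
  set α : ℂ := aeval ζ (1 + X + X ^ 4 : ℤ[X]) with hα
  have hζint : IsIntegral ℤ ζ := hζ.isIntegral (by norm_num)
  have hαint : IsIntegral ℤ α := by
    have hmem : α ∈ Algebra.adjoin ℤ {ζ} := Polynomial.aeval_mem_adjoin_singleton ℤ ζ
    exact (mem_integralClosure_iff ℤ ℂ).1 (adjoin_le_integralClosure hζint hmem)
  refine ⟨?_, ?_, hdeg, by rw [hM, hdeg]⟩
  · intro h0
    have h := aeval_goldenPoly_one_add_zeta_five hζ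
    rw [← hα, h0] at h
    simp at h
  · intro k hk hk1
    -- a root of unity has a cyclotomic minimal polynomial, of Mahler measure `1 ≠ φ`
    have hfin : IsOfFinOrder α := isOfFinOrder_iff_pow_eq_one.2 ⟨k, hk, hk1⟩
    have hj : 0 < orderOf α := hfin.orderOf_pos
    have hprim : IsPrimitiveRoot α (orderOf α) := IsPrimitiveRoot.orderOf α
    have hcyc : cyclotomic (orderOf α) ℤ = minpoly ℤ α := cyclotomic_eq_minpoly hprim hj
    have h1 : intMahlerMeasure (minpoly ℤ α) = 1 := by rw [← hcyc]; exact intMahlerMeasure_cyclotomic _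
    rw [hα] at h1
    rw [h1] at hM
    exact (Real.one_lt_goldenRatio).ne hM

end Literature.NumberTheory.MahlerMeasure

end Part8

/-!
## Part 9 — port of `Summits/Ventures/DiscreteObjects/Mahler/CyclotomicIntegerHouse.lean` (1 declarations kept)

# A uniform house bound for cyclotomic integers (venture `DiscreteObjects`, target L)

Cell `pub-namedobj`, seat `pub-namedobj-mahler-g28`. Framing: lottery ticket; floor = certified bounds/negative ranges.

Corollary of Lehmer's conjecture for cyclotomic integers in the strong form `(5/2)^{deg α} ≤ M(α)^{10}`
([cite: BombieriGubler2001, Theorem 4.4.9], `CyclotomicIntegerLehmerAll`): since `M(α) ≤ house(α)^{deg α}`, every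
nonzero non-torsion cyclotomic integer `α = g(ζ_m)` has a conjugate of modulus `≥ (5/2)^{1/10} = 1.0959…`
(`exists_conjugate_norm_pow_ten_ge`) — a Schinzel–Zassenhaus bound for the integers of abelian (cyclotomic) fields,
UNIFORM in the degree (the general theorem, Dimitrov 2019, gives `2^{1/(4d)}`).  Bookkeeping; no new mathematics
claimed.
-/

section Part9

namespace Literature.NumberTheory.MahlerMeasure

open _root_.Polynomial

/-- **A uniform Schinzel–Zassenhaus bound for cyclotomic integers**: every nonzero non-torsion cyclotomic integer
`α = g(ζ_m)` has a conjugate `β` (a complex root of `minpoly_ℤ α`) with `|β|^{10} ≥ 5/2`, i.e. house `≥ (5/2)^{1/10}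
= 1.0959…`, uniformly in the degree (from `(5/2)^{deg α} ≤ M(α)^{10} ≤ house(α)^{10 deg α}`).
[cite: BombieriGubler2001, Theorem 4.4.9 p.110 (consequence: a uniform house bound — some conjugate of a cyclotomic integer which is not 0 or a root of unity has |α'|¹⁰ ≥ 2)] -/
theorem exists_conjugate_norm_pow_ten_ge {m : ℕ} (hm : 0 < m) (g : ℤ[X]) {ζ : ℂ} (hζ : IsPrimitiveRoot ζ m)
    (h0 : aeval ζ g ≠ 0) (hnu : ∀ k : ℕ, 0 < k → aeval ζ g ^ k ≠ 1) :
    ∃ β ∈ ((minpoly ℤ (aeval ζ g)).map (Int.castRingHom ℂ)).roots, (5 : ℝ) / 2 ≤ ‖β‖ ^ 10 := by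
  classical
  have hαint : IsIntegral ℤ (aeval ζ g) := isIntegral_aeval_of_isPrimitiveRoot hm g hζ
  set f : ℤ[X] := minpoly ℤ (aeval ζ g) with hf
  have hmon : f.Monic := minpoly.monic hαint
  have hB := cyclotomicInteger_lehmer_bound_all hm g hζ h0 hnu
  have hL := lehmer_of_cyclotomicInteger_all hm g hζ h0 hnu
  have hLlow := lehmer_measure_lower_bound
  have hM : 1 < intMahlerMeasure f := by rw [hf]; linarith
  obtain ⟨z, hz, hz1, hmax⟩ := exists_root_norm_gt_one hmon hM
  refine ⟨z, hz, ?_⟩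
  set d := f.natDegree with hd
  have hdpos : 0 < d := minpoly.natDegree_pos hαint
  set RC := (f.map (Int.castRingHom ℂ)).roots with hRC
  have hcard : RC.card = d := by
    rw [hRC, splits_iff_card_roots.1 (IsAlgClosed.splits _),
      natDegree_map_eq_of_injective (Int.castRingHom ℂ).injective_int]
  have hMle : intMahlerMeasure f ≤ ‖z‖ ^ d := by
    have hMf : intMahlerMeasure f = (RC.map fun γ => max 1 ‖γ‖).prod := by
      unfold intMahlerMeasure
      rw [mahlerMeasure_eq_leadingCoeff_mul_prod_roots, (hmon.map (Int.castRingHom ℂ)).leadingCoeff, norm_one,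
        one_mul]
    rw [hMf]
    calc (RC.map fun γ => max 1 ‖γ‖).prod ≤ (RC.map fun _ => ‖z‖).prod :=
          Multiset.prod_map_le_prod_map₀ _ _ (fun γ _ => by positivity) (fun γ hγ => max_le hz1.le (hmax γ hγ))
      _ = ‖z‖ ^ d := by rw [Multiset.map_const', Multiset.prod_replicate, hcard]
  have hM0 : 0 ≤ intMahlerMeasure f := by linarith
  have h1 : ((5 : ℝ) / 2) ^ d ≤ (‖z‖ ^ 10) ^ d := by
    calc ((5 : ℝ) / 2) ^ d ≤ intMahlerMeasure f ^ 10 := hB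
      _ ≤ (‖z‖ ^ d) ^ 10 := pow_le_pow_left₀ hM0 hMle 10
      _ = (‖z‖ ^ 10) ^ d := by rw [← pow_mul, ← pow_mul, mul_comm]
  exact (pow_le_pow_iff_left₀ (by norm_num) (by positivity) hdpos.ne').1 h1

end Literature.NumberTheory.MahlerMeasure

end Part9

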